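import Summits.BirchSwinnertonDyer.BirchSwinnertonDyer.Theorems.KolyvaginDepthDoorDepthTableKuriharaExactSides
import Summits.BirchSwinnertonDyer.BirchSwinnertonDyer.Theorems.KolyvaginDepthDoorKNSupplyExactReadingZhang
import HarnessLib

/-!
# Route `KolyvaginDepthDoor`, crux `KolyvaginDepthSupplyKN` (stmt-BirchSwinnertonDyer-22820) —
# DEPTH TABLE v18, GENERIC (part 3 of 3): THE ROW, EXACTLY — «ONE ANTICYCLOTOMIC BIT ⟺ TWO CYCLOTOMIC
# BITS» per `(E, p, K)` on W. Zhang's ♠ cell, and the finite falsifier of a row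

Helper file of the lead prover of line `levelone` (kdd-p1 g22; `--supports stmt-BirchSwinnertonDyer-22820
--as helper`); it closes nothing and BSD is NOT proved by it. Sequel of `…DepthTableKuriharaExact{,Sides}`.

* §4 `kolyvaginClass_rankClause_iff_kuriharaBits_of_lemma84` — on the ♠ cell the `∃`-body of the crux
  `KolyvaginDepthSupplyKN` at `(W, p, K)` («some frame, some square-free product `n₁` of Kolyvagin primes,
  some Kolyvagin–Heegner datum with `c_1(n₁) ≠ 0` and the signed rank clause») ⟺ (E-bit: a unit mod-`p`
  Kurihara number of `E` at a cyclic level of depth `≤ rank E`, for every admissible datum) ∧ ((T-bit of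
  depth `≤ rank E` for a minimal model `T` of `E^{(d_K)}`) ∨ (T-bit of depth `≤ rank E^{(d_K)}` ∧
  `rank E^{(d_K)} = rank E + 1`)) — g14's exact reading `kolyvaginClass_rankClause_iff_shaTrivial_twistCondition_of_lemma84`
  («clause ⟺ `Ш(E)[p] = 0 ∧ TC`», (γ) + W. Zhang L8.4 (1)/9.1 by name) composed with the E-side and
  twist-side IFFs of `…KuriharaExactSides`.
* §5′ `not_kolyvaginClass_rankClause_of_isDeltaMinimal_twist` — a `δ`-minimal cyclic level of the minimal
  twist model of depth `≥ rank E + 2` REFUTES the clause at `(W, p, K)` ((γ) + Sakamoto Thm. 1.5 only).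

READING. With v17 (⟸) and v18 (⟹) the depth door (anticyclotomic, derived Heegner classes) and the
Kurihara door (cyclotomic, Kato's Euler system read through modular symbols) certify THE SAME algebraic bits
`Ш(E/ℚ)[p] = 0 ∧ TC(E, p, K)` at every admissible `(E, p, K)` of the cell, each modulo its own print:
(γ) + W. Zhang 2014 on one side, Kim 2026 / Sakamoto 2022 (+ Kato, Burungale–Castella–Skinner) +
modularity + Mazur on the other. CONDITIONAL on the SEVEN named facts displayed; per `(W, p, K)`; nothing
class-wide (the open stub (S♭) is untouched); BSD is NOT proved by any of this.

References: [Sakamoto2022pSelmer] R. Sakamoto, Doc. Math. 27 (2022) 1891–1922 = arXiv:2106.03370, §1 (a)–(c),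
Conj. 1.1, Thm. 1.2, Def. 1.4, Thm. 1.5, Rem. 1.6, Prop. 3.16, Cor. 4.3, Thm. 4.8; [Kim2022StructureSelmer] C.-H. Kim,
Amer. J. Math. 148 (2026) 79–129 = arXiv:2203.12159, Thm. 1.11, §1.2.2, §1.4, §6; [Kurihara2014] M. Kurihara,
Contrib. Math. Comput. Sci. 7 (2014) = arXiv:1407.2465, Thm. 1.2.3, Conj. 1.2.4; [BurungaleCastellaSkinner2025]
Thm. 1.1.2 (b); [Kato2004Asterisque] Thm. 17.4; [Mazur1978] Cor. 4.1; [WZhang2014] Lemma 8.4 (1), Thm. 9.1;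
[GrossLMS1991] Prop. 3.7 (2); [SilvermanAEC2009] X.4.2, X.5 Cor. 5.4.
-/

set_option linter.dupNamespace false

noncomputable section

open scoped Classical NumberField

namespace Summit.BirchSwinnertonDyer.BirchSwinnertonDyer.Theorems.KolyvaginDepthDoor

open Literature.NumberTheory.EllipticCurves Literature.NumberTheory.EllipticCurves.ModularForms
  WeierstrassCurve NumberField IsDedekindDomain CongruenceSubgroup
open Summit.BirchSwinnertonDyer.BirchSwinnertonDyer.Theorems

/-! ## §4 THE ROW, EXACTLY (W. Zhang's ♠ cell): the crux's clause at `(W, p, K)` ⟺ two Kurihara bits -/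

/-- **THE EXACT KURIHARA READING OF A DEPTH-TABLE ROW — «ONE ANTICYCLOTOMIC BIT ⟺ TWO CYCLOTOMIC BITS».**
On W. Zhang's ♠ cell (`W` non-CM globally minimal; `p ≥ 5` good ordinary, `ρ_{E,p^n}` onto for all `n`,
Kodaira–Néron in both currencies, ♠ (2), `a_p ≢ 1 (mod p)`; `K` imaginary quadratic Heegner for `N_E`,
`d_K ∉ {−3, −4}`, `p ∤ d_K`; `T` ANY globally minimal model of `E^{(d_K)}` with `a_p(T) ≢ 1` and
Kodaira–Néron at `p`): the `∃`-body of the crux `KolyvaginDepthSupplyKN` at `(W, p, K)` — «some frame,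
some square-free product `n₁` of Kolyvagin primes, some Kolyvagin–Heegner datum with `c_1(n₁) ≠ 0` and the
signed rank clause» — holds IF AND ONLY IF
(E-bit) every admissible datum of `W` has a unit mod-`p` Kurihara number at a cyclic level of depth
`≤ rank E`, AND ((T-bit) every admissible datum of `T` has one at a cyclic level of depth `≤ rank E`, OR
the same at depth `≤ rank E^{(d_K)}` together with `rank E^{(d_K)} = rank E + 1`).
`=` g14's exact reading `kolyvaginClass_rankClause_iff_shaTrivial_twistCondition_of_lemma84` («clause ⟺
`Ш(E)[p] = 0 ∧ TC`», (γ) + W. Zhang L8.4 (1)/9.1 by name) ∘ §2 ∘ §3. CONDITIONAL on the SEVEN named facts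
displayed; per `(W, p, K)`; nothing class-wide; BSD is NOT proved by it.
[cite: Sakamoto2022pSelmer, Thm. 1.2, Thm. 1.5] [cite: Kim2022StructureSelmer, Thm. 1.11]
[cite: WZhang2014, Lemma 8.4 (1) (p. 236), Thm. 9.1 (p. 240)] [cite: GrossLMS1991, Prop. 3.7 (2)] -/
theorem kolyvaginClass_rankClause_iff_kuriharaBits_of_lemma84
    (h372 : GrossLMS1991.prop37_2_frobeniusCongruence)
    (h84 : Literature.NumberTheory.EllipticCurves.WZhang2014_lemma84_exists_minimal_kolyvaginClass_one_selmerCard)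
    (hKim : Kim2022_card_selmerGroup_le_pow_of_kuriharaNumber_ne_zero)
    (hSak1 : Sakamoto2022_card_selmerGroup_eq_pow_of_isDeltaMinimal)
    (hSak2 : Sakamoto2022_exists_cyclicLevel_kuriharaNumber_ne_zero) (hnf : exists_isNewformOf)
    (hMaz : mazur_not_dvd_maninConstant_of_odd)
    (W : WeierstrassCurve ℚ) [W.IsElliptic] [W.IsGloballyMinimal] (hcm : ¬ W.HasCM)
    (p : ℕ) [hp : Fact p.Prime] (h5 : 5 ≤ p) (hgood : W.HasGoodReductionAtPrime p)
    (hord : ¬ (p : ℤ) ∣ W.frobeniusTrace p)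
    (htower : ∀ n : ℕ, W.HasSurjectiveModNGaloisRep (p ^ n : ℕ))
    (hKN : ∀ v : HeightOneSpectrum (𝓞 ℚ), W.HasMultiplicativeReductionAt v →
      ¬ p ∣ W.ordMinimalDiscriminant v)
    (hna : ¬ (p : ℤ) ∣ W.frobeniusTrace p - 1)
    (hS1 : ∀ (ℓ : ℕ) [Fact ℓ.Prime], W.HasMultiplicativeReductionAtPrime ℓ →
      ¬ p ∣ padicValInt ℓ W.minimalDiscriminantInt)
    (hS2 : ¬ Squarefree (W.conductorNorm ℤ) →
      (∃ (ℓ : ℕ) (_ : Fact ℓ.Prime), W.HasMultiplicativeReductionAtPrime ℓ ∧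
          ¬ p ∣ padicValInt ℓ W.minimalDiscriminantInt) ∧
        ∃ (ℓ₁ ℓ₂ : ℕ) (_ : Fact ℓ₁.Prime) (_ : Fact ℓ₂.Prime), ℓ₁ ≠ ℓ₂ ∧
          W.HasMultiplicativeReductionAtPrime ℓ₁ ∧ W.HasMultiplicativeReductionAtPrime ℓ₂)
    (K : Type) [Field K] [NumberField K] (hK : IsImaginaryQuadratic K)
    (hD3 : NumberField.discr K ≠ -3) (hD4 : NumberField.discr K ≠ -4)
    (hpD : ¬ ((p : ℤ) ∣ NumberField.discr K))
    [iNZ : NeZero (W.conductorNorm ℤ)] (hH : SatisfiesHeegnerHypothesis (W.conductorNorm ℤ) K)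
    (T : WeierstrassCurve ℚ) [T.IsElliptic] [T.IsGloballyMinimal] (C : VariableChange ℚ)
    (hC : C • T = W.quadraticTwist (NumberField.discr K : ℚ))
    (hTna : ¬ (p : ℤ) ∣ T.frobeniusTrace p - 1)
    (hTKN : ∀ v : HeightOneSpectrum (𝓞 ℚ), T.HasMultiplicativeReductionAt v → ¬ p ∣ T.ordMinimalDiscriminant v)
    [iNZT : NeZero (T.conductorNorm ℤ)] :
    (∃ (Dt : ModularParametrizationData W (W.conductorNorm ℤ)) (β : ℤ) (ι : K →+* ℂ) (n₁ : ℕ)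
      (d : KolyvaginHeegnerData Dt β ι n₁), Squarefree n₁ ∧
        (∀ q ∈ n₁.primeFactors, Zhang2014.IsKolyvaginPrime (W.conductorNorm ℤ) W K p q) ∧
        d.kolyvaginClass hp.out 1 ≠ 0 ∧
        (n₁.primeFactors.card + 1 ≤ W.mordellWeilRank ∨
          (n₁.primeFactors.card ≤ W.mordellWeilRank ∧
            n₁.primeFactors.card + 1 ≤ (W.quadraticTwist (NumberField.discr K : ℚ)).mordellWeilRank))) ↔
    ((∀ (D : ModularParametrizationData W (W.conductorNorm ℤ)), ¬ (p : ℤ) ∣ D.maninConstant →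
        (∃ u : ℚ, ‖(u : ℚ_[p])‖ = 1 ∧ W.realPeriodRat = u * plusPeriod D.f) →
        ∃ (n : ℕ) (_ : NeZero n), IsCyclicKolyvaginLevel W p n ∧ n.primeFactors.card ≤ W.mordellWeilRank ∧
          ∃ ψ : (ℓ : ℕ) → (ZMod ℓ)ˣ →* Multiplicative (ZMod p),
            (∀ ℓ ∈ n.primeFactors, Function.Surjective (ψ ℓ)) ∧ kuriharaNumber D.f p n ψ ≠ 0) ∧
      ((∀ (D : ModularParametrizationData T (T.conductorNorm ℤ)), ¬ (p : ℤ) ∣ D.maninConstant →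
          (∃ u : ℚ, ‖(u : ℚ_[p])‖ = 1 ∧ T.realPeriodRat = u * plusPeriod D.f) →
          ∃ (m : ℕ) (_ : NeZero m), IsCyclicKolyvaginLevel T p m ∧ m.primeFactors.card ≤ W.mordellWeilRank ∧
            ∃ ψ : (ℓ : ℕ) → (ZMod ℓ)ˣ →* Multiplicative (ZMod p),
              (∀ ℓ ∈ m.primeFactors, Function.Surjective (ψ ℓ)) ∧ kuriharaNumber D.f p m ψ ≠ 0) ∨
        ((∀ (D : ModularParametrizationData T (T.conductorNorm ℤ)), ¬ (p : ℤ) ∣ D.maninConstant →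
            (∃ u : ℚ, ‖(u : ℚ_[p])‖ = 1 ∧ T.realPeriodRat = u * plusPeriod D.f) →
            ∃ (m : ℕ) (_ : NeZero m), IsCyclicKolyvaginLevel T p m ∧
              m.primeFactors.card ≤ (W.quadraticTwist (NumberField.discr K : ℚ)).mordellWeilRank ∧
              ∃ ψ : (ℓ : ℕ) → (ZMod ℓ)ˣ →* Multiplicative (ZMod p),
                (∀ ℓ ∈ m.primeFactors, Function.Surjective (ψ ℓ)) ∧ kuriharaNumber D.f p m ψ ≠ 0) ∧
          (W.quadraticTwist (NumberField.discr K : ℚ)).mordellWeilRank = W.mordellWeilRank + 1))) := by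
  have hsur : W.HasSurjectiveModNGaloisRep p := by simpa only [pow_one] using htower 1
  have hirr : W.HasIrreducibleModPGaloisRep p := hasIrreducibleModPGaloisRep_of_hasSurjectiveModNGaloisRep W p hsur
  have hdK : NumberField.discr K ≠ 0 := NumberField.discr_ne_zero K
  have hdKq : (NumberField.discr K : ℚ) ≠ 0 := by exact_mod_cast hdK
  haveI hTw : (W.quadraticTwist (NumberField.discr K : ℚ)).IsElliptic := W.isElliptic_quadraticTwist hdKq
  have hirrT : (W.quadraticTwist (NumberField.discr K : ℚ)).HasIrreducibleModPGaloisRep p :=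
    (W.hasIrreducibleModPGaloisRep_quadraticTwist_iff hdKq p).mpr hirr
  -- the three rewrites
  have hE := sha_inf_torsionBy_eq_bot_iff_kuriharaBit hKim hSak1 hSak2 hnf hMaz W p h5 hgood hord hsur hna hKN
  have hT1 := natCard_selmerGroup_quadraticTwist_le_iff_kuriharaBit hKim hSak1 hSak2 hnf hMaz W p h5 hgood hord hsur
    hdK hpD T C hC hTna hTKN W.mordellWeilRank
  have hT2 := natCard_selmerGroup_quadraticTwist_le_iff_kuriharaBit hKim hSak1 hSak2 hnf hMaz W p h5 hgood hord hsur
    hdK hpD T C hC hTna hTKN (W.quadraticTwist (NumberField.discr K : ℚ)).mordellWeilRank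
  have hShaT : ((W.quadraticTwist (NumberField.discr K : ℚ)).sha ⊓
      AddSubgroup.torsionBy (W.quadraticTwist (NumberField.discr K : ℚ)).galH1 (p : ℤ) :
      AddSubgroup (W.quadraticTwist (NumberField.discr K : ℚ)).galH1) = ⊥ ↔
      Nat.card ((W.quadraticTwist (NumberField.discr K : ℚ)).selmerGroup p) ≤
        p ^ (W.quadraticTwist (NumberField.discr K : ℚ)).mordellWeilRank :=
    ⟨fun h ↦ (natCard_selmerGroup_eq_pow_rank_of_sha_inf_torsionBy_eq_bot _ p hirrT h).le,
      sha_inf_torsionBy_eq_bot_of_natCard_selmerGroup_le _ p⟩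
  rw [kolyvaginClass_rankClause_iff_shaTrivial_twistCondition_of_lemma84 h372 h84 W hcm p h5 hgood hord htower
    hKN hS1 hS2 K hK hD3 hD4 hpD hH, hE, hT1, hShaT, hT2]

/-! ## §5′ The finite falsifier of a row -/

/-- **FINITE FALSIFIER OF A ROW: a `δ`-minimal cyclic level of the minimal twist model `T` of depth
`≥ rank E + 2` refutes the crux's clause at `(W, p, K)`** (the door direction of g14's exact reading,
(γ) only: clause ⟹ `Ш(E)[p] = 0 ∧ TC`; and `not_twistCondition_of_isDeltaMinimal_twist`). On the ♠/KN cell: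
`W` non-CM globally minimal, `p ≥ 5`, tower onto, Kodaira–Néron; `K` imaginary quadratic Heegner with
`d_K ∉ {−3, −4}`, `p ∤ d_K`. A row killed this way is dead at `(p, K)` only — the crux is `∃ p ∃ K`.
CONDITIONAL on (γ) `h372` and `hSak1`; per `(W, p, K)`; BSD is not proved by it.
[cite: Sakamoto2022pSelmer, Thm. 1.5] [cite: GrossLMS1991, Prop. 3.7 (2)] [cite: Kolyvagin1991MathAnn, Thm. 2.3] -/
theorem not_kolyvaginClass_rankClause_of_isDeltaMinimal_twist
    (hSak1 : Sakamoto2022_card_selmerGroup_eq_pow_of_isDeltaMinimal)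
    (h372 : GrossLMS1991.prop37_2_frobeniusCongruence)
    (W : WeierstrassCurve ℚ) [W.IsElliptic] [W.IsGloballyMinimal] (hcm : ¬ W.HasCM)
    (p : ℕ) [hp : Fact p.Prime] (h5 : 5 ≤ p) (hgood : W.HasGoodReductionAtPrime p)
    (hord : ¬ (p : ℤ) ∣ W.frobeniusTrace p)
    (htower : ∀ n : ℕ, W.HasSurjectiveModNGaloisRep (p ^ n : ℕ))
    (hKN : ∀ v : HeightOneSpectrum (𝓞 ℚ), W.HasMultiplicativeReductionAt v →
      ¬ p ∣ W.ordMinimalDiscriminant v)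
    (K : Type) [Field K] [NumberField K] (hK : IsImaginaryQuadratic K)
    (hD3 : NumberField.discr K ≠ -3) (hD4 : NumberField.discr K ≠ -4)
    (hpD : ¬ ((p : ℤ) ∣ NumberField.discr K))
    [iNZ : NeZero (W.conductorNorm ℤ)] (hH : SatisfiesHeegnerHypothesis (W.conductorNorm ℤ) K)
    (T : WeierstrassCurve ℚ) [T.IsElliptic] [T.IsGloballyMinimal] (C : VariableChange ℚ)
    (hC : C • T = W.quadraticTwist (NumberField.discr K : ℚ))
    (hTna : ¬ (p : ℤ) ∣ T.frobeniusTrace p - 1)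
    (hTKN : ∀ v : HeightOneSpectrum (𝓞 ℚ), T.HasMultiplicativeReductionAt v → ¬ p ∣ T.ordMinimalDiscriminant v)
    {N : ℕ} [NeZero N] (D : ModularParametrizationData T N) (hc : ¬ (p : ℤ) ∣ D.maninConstant)
    (hu : ∃ u : ℚ, ‖(u : ℚ_[p])‖ = 1 ∧ T.realPeriodRat = u * plusPeriod D.f)
    (m : ℕ) [NeZero m] (hm : IsCyclicKolyvaginLevel T p m)
    (ψ : (ℓ : ℕ) → (ZMod ℓ)ˣ →* Multiplicative (ZMod p)) (hψ : ∀ ℓ ∈ m.primeFactors, Function.Surjective (ψ ℓ))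
    (hmin : Sakamoto2024.IsDeltaMinimal D.f p m ψ) (hdepth : W.mordellWeilRank + 2 ≤ m.primeFactors.card) :
    ¬ ∃ (Dt : ModularParametrizationData W (W.conductorNorm ℤ)) (β : ℤ) (ι : K →+* ℂ) (n₁ : ℕ)
      (d : KolyvaginHeegnerData Dt β ι n₁), Squarefree n₁ ∧
        (∀ q ∈ n₁.primeFactors, Zhang2014.IsKolyvaginPrime (W.conductorNorm ℤ) W K p q) ∧
        d.kolyvaginClass hp.out 1 ≠ 0 ∧
        (n₁.primeFactors.card + 1 ≤ W.mordellWeilRank ∨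
          (n₁.primeFactors.card ≤ W.mordellWeilRank ∧
            n₁.primeFactors.card + 1 ≤ (W.quadraticTwist (NumberField.discr K : ℚ)).mordellWeilRank)) := by
  intro hclause
  have hsur : W.HasSurjectiveModNGaloisRep p := by simpa only [pow_one] using htower 1
  obtain ⟨-, hTC⟩ := shaTrivial_twistCondition_of_kolyvaginClass_rankClause_kodairaNeron h372 W hcm p h5 htower hKN
    K hK hD3 hD4 hH hclause
  exact not_twistCondition_of_isDeltaMinimal_twist hSak1 W p h5 hgood hord hsur (NumberField.discr_ne_zero K) hpD T C
    hC hTna hTKN D hc hu m hm ψ hψ hmin hdepth hTC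

end Summit.BirchSwinnertonDyer.BirchSwinnertonDyer.Theorems.KolyvaginDepthDoor

end
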